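import Literature.NumberTheory.ComplexMultiplication.FiniteQAlgebraMultiplicativeMetricCriterion
import Mathlib.Algebra.DualNumber
import Mathlib.RingTheory.Adjoin.PowerBasis
import Mathlib.FieldTheory.Minpoly.Field
import HarnessLib

/-!
# Hertling–Larabi 2026b REMARKS 3.4 (iv): `ℚ[x, y]/(x², y²)` is Gorenstein (it has a multiplicative metric) but it
# is NOT cyclic

[topic NumberTheory/ComplexMultiplication] General-`A` series (namespace
`Literature.NumberTheory.ComplexMultiplication.FiniteQAlgebraLattice`); sequel of
`FiniteQAlgebraMultiplicativeMetricCriterion` (Rem. 3.4 (i): `φ_l(a,b) = l(ab)` is a multiplicative metric iff no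
non-zero ideal lies in `ker l`; Rem. 3.4 (v): `ℚ[x,y]/(x²,xy,y²)` is not Gorenstein) and `FiniteQAlgebraLatticeMetricDual`
(Rem. 3.4 (ii): cyclic algebras are Gorenstein).  Supplied here: Rem. 3.4 (iv), the example separating «Gorenstein»
from «cyclic».  Lane `lit-hodgefound` (Track 2 foundations library), seat p19 generation 38, row g38-#5.  THEOREMS
ONLY: no definition, no instance, no notation, no named fact (D-0026, net Literature debt `0`), no `sorry`.

MODEL.  HL's `A = ℚ[x, y]/(x², y²)` is Mathlib's `DualNumber (DualNumber ℚ) = ℚ[ε₁][ε₂]` with `x = ε₁ = inl ε`,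
`y = ε₂ = inr 1`: `x² = 0`, `y² = 0`, `xy = inr ε`, `dim_ℚ = 4`, every element is `α + βx + γy + δxy` with
`(α, β, γ, δ) = (a.fst.fst, a.fst.snd, a.snd.fst, a.snd.snd)` (`dualNumber_dualNumber_presentation`,
`finrank_dualNumber_dualNumber`).  «Multiplicative metric» (Def. 3.3 (b)) is, as in the sequel files,
`((LinearMap.mul ℚ A).compr₂ l).Nondegenerate` for a linear form `l`; «cyclic» (Def. 3.3 (a)) is
`Algebra.adjoin ℚ {a} = ⊤` for some `a`.

## Source, VERBATIM

C. Hertling, K. Larabi, *Conjugacy classes of regular integer matrices*, arXiv:2602.15748 (2026)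
[HertlingLarabi2026b], held `paper:arxiv-2602.15748`, §3 (chunk p0006): «**Definition 3.3.** Let `A` be as in
Theorem 3.1. (a) `A` is called cyclic if it contains an element `a` with `A = ℚ[a]`. (b) A symmetric `ℚ`-bilinear
form `Φ : A × A → ℚ` is multiplication invariant if `Φ(ab, c) = Φ(a, bc)` for `a, b, c ∈ A`. A symmetric
`ℚ`-bilinear form which is multiplication invariant and nondegenerate is called multiplicative metric. If `A` has a
multiplicative metric then `A` is a Gorenstein ring. **Remarks 3.4.** […] (i) It is well known and easy to see
that `A` is a Gorenstein ring if and only if for each `j ∈ {1, ..., k}` the socle `Ann_{A^{(j)}}(N^{(j)}) ⊂ A^{(j)}`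
of `A^{(j)}` is a 1-dimensional vector space over `F^{(j)}`. In that case any `ℚ`-linear form `l : A → ℚ` with
`Ann_{A^{(j)}}(N^{(j)}) ⊄ ker(l)` for `j ∈ {1, ..., k}` gives rise to a multiplicative metric via `φ(a, b) := l(ab)`
(3.2), and any multiplicative metric is constructed in this way. (ii) Any cyclic algebra is Gorenstein. […]
(iv) The algebra `A = ℚ[x, y]/(x², y²)` is Gorenstein, but not cyclic. (v) The algebra `A = ℚ[x, y]/(x², xy, y²)`
is not Gorenstein (so also not cyclic), as it is irreducible with 2-dimensional socle.»

## What is proved (`A := DualNumber (DualNumber ℚ)`)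

* §1 the model: `finrank_dualNumber_dualNumber` (`dim = 4`), `dualNumber_dualNumber_presentation` (`x² = y² = 0`,
  `xy`, coordinates).
* §2 **`dualNumber_dualNumber_nondegenerate`** — the linear form `l =` (coefficient of `xy`) makes `l(ab)` a
  MULTIPLICATIVE METRIC: `l(a·xy), l(a·y), l(a·x), l(a·1)` are the four coordinates of `a` (equivalently, Rem. 3.4
  (i): `A` is local with 1-dimensional socle `ℚ·xy ⊄ ker l`); `dualNumber_dualNumber_exists_nondegenerate`
  (**`A` is Gorenstein** in HL's sense).
* §3 `dualNumber_dualNumber_sub_algebraMap_pow_three` (`(a − α)³ = 0`), `toSubmodule_adjoin_le_span`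
  (`ℚ[a] ⊆ ℚ + ℚa + ℚa²`: polynomials in `a` reduce modulo `(t − α)³`), **`dualNumber_dualNumber_not_cyclic`**
  (**no `a` with `ℚ[a] = A`**, as `dim ℚ[a] ≤ 3 < 4`), and the remark as one statement
  `dualNumber_dualNumber_gorenstein_not_cyclic`.
NOT here: the abstract ring-theoretic notion «Gorenstein» (Mathlib has no `IsGorenstein`); as in the sequel files the
formalised content of «Gorenstein» is HL's own criterion, the existence of a multiplicative metric (Def. 3.3 (b) with
Rem. 3.4 (i)).

## References

* [HertlingLarabi2026b] C. Hertling, K. Larabi, arXiv:2602.15748 (2026), §3 Def. 3.3 (a)(b), Rem. 3.4 (i), (ii),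
  (iv), (v) (chunk p0006). [cite: HertlingLarabi2026b, §3 Rem. 3.4 (iv), chunk p0006]
-/

noncomputable section

open Module TrivSqZeroExt Polynomial

namespace Literature.NumberTheory.ComplexMultiplication.FiniteQAlgebraLattice

/-! ## §1 The model `ℚ[ε₁][ε₂] = DualNumber (DualNumber ℚ)` of `ℚ[x, y]/(x², y²)` -/

/-- `A := ℚ[ε][ε]` is a finite `ℚ`-module (its `ℚ`-module structure is that of `(ℚ × ℚ) × (ℚ × ℚ)`).
[cite: HertlingLarabi2026b, §3 Rem. 3.4 (iv), chunk p0006] -/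
theorem moduleFinite_dualNumber_dualNumber : Module.Finite ℚ (DualNumber (DualNumber ℚ)) :=
  inferInstanceAs (Module.Finite ℚ ((ℚ × ℚ) × (ℚ × ℚ)))

/-- **`dim_ℚ ℚ[ε₁][ε₂] = 4`** (= `dim ℚ[x,y]/(x²,y²)`, basis `1, x, y, xy`).
[cite: HertlingLarabi2026b, §3 Rem. 3.4 (iv), chunk p0006] -/
theorem finrank_dualNumber_dualNumber : finrank ℚ (DualNumber (DualNumber ℚ)) = 4 := by
  change finrank ℚ ((ℚ × ℚ) × (ℚ × ℚ)) = 4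
  rw [Module.finrank_prod, Module.finrank_prod, Module.finrank_self]

/-- **The presentation `ℚ[x, y]/(x², y²)`**: with `x := ε₁ = inl ε` and `y := ε₂ = inr 1` one has `x² = 0`,
`y² = 0`, `xy = inr ε`, and every element is `α + βx + γy + δxy` with `(α, β, γ, δ)` its four coordinates — so
`DualNumber (DualNumber ℚ)` IS HL's algebra `A = ℚ[x, y]/(x², y²)` (4-dimensional, `finrank_dualNumber_dualNumber`).
[cite: HertlingLarabi2026b, §3 Rem. 3.4 (iv), chunk p0006] -/
theorem dualNumber_dualNumber_presentation (a : DualNumber (DualNumber ℚ)) :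
    (inl DualNumber.eps : DualNumber (DualNumber ℚ)) * inl DualNumber.eps = 0 ∧
      (inr 1 : DualNumber (DualNumber ℚ)) * inr 1 = 0 ∧
      (inl DualNumber.eps : DualNumber (DualNumber ℚ)) * inr 1 = inr DualNumber.eps ∧
      a = algebraMap ℚ (DualNumber (DualNumber ℚ)) a.fst.fst + a.fst.snd • (inl DualNumber.eps) +
        a.snd.fst • (inr 1 : DualNumber (DualNumber ℚ)) + a.snd.snd • (inr DualNumber.eps) := by
  refine ⟨?_, inr_mul_inr _ _ _, ?_, ?_⟩
  · rw [← inl_mul, DualNumber.eps_mul_eps, inl_zero]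
  · rw [inl_mul_inr, smul_eq_mul, mul_one]
  · refine TrivSqZeroExt.ext (TrivSqZeroExt.ext ?_ ?_) (TrivSqZeroExt.ext ?_ ?_) <;>
      simp [TrivSqZeroExt.algebraMap_eq_inl']

/-! ## §2 REMARK 3.4 (iv), first half: `A` is Gorenstein — the coefficient of `xy` gives a multiplicative metric -/

/-- **REMARK 3.4 (iv), «The algebra `A = ℚ[x,y]/(x²,y²)` is Gorenstein»: the linear form `l(a) :=` (coefficient of
`xy`) makes `φ(a, b) = l(ab)` a MULTIPLICATIVE METRIC** (nondegenerate: `l(a·xy) = α`, `l(a·y) = β`, `l(a·x) = γ`,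
`l(a·1) = δ` recover the four coordinates of `a = α + βx + γy + δxy`; by Rem. 3.4 (i), `A` local with
1-dimensional socle `ℚ·xy ⊄ ker l`). [cite: HertlingLarabi2026b, §3 Def. 3.3 (b) and Rem. 3.4 (i), (iv), chunk p0006] -/
theorem dualNumber_dualNumber_nondegenerate :
    ((LinearMap.mul ℚ (DualNumber (DualNumber ℚ))).compr₂
      ((TrivSqZeroExt.sndHom ℚ ℚ).comp
        ((TrivSqZeroExt.sndHom (DualNumber ℚ) (DualNumber ℚ)).restrictScalars ℚ))).Nondegenerate := by
  refine (nondegenerate_compr₂_mul_iff (A := DualNumber (DualNumber ℚ)) _).2 fun a ha => ?_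
  have h := fun b : DualNumber (DualNumber ℚ) => ha b
  simp only [LinearMap.coe_comp, LinearMap.coe_restrictScalars, Function.comp_apply,
    TrivSqZeroExt.sndHom_apply] at h
  have h1 := h (inr DualNumber.eps)
  have h2 := h (inr 1)
  have h3 := h (inl DualNumber.eps)
  have h4 := h 1
  simp [TrivSqZeroExt.snd_mul] at h1 h2 h3 h4
  exact TrivSqZeroExt.ext (TrivSqZeroExt.ext h1 h2) (TrivSqZeroExt.ext h3 h4)

/-- **`ℚ[x, y]/(x², y²)` HAS a multiplicative metric (is Gorenstein).** [cite: HertlingLarabi2026b, §3 Rem. 3.4 (iv), chunk p0006] -/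
theorem dualNumber_dualNumber_exists_nondegenerate :
    ∃ l : DualNumber (DualNumber ℚ) →ₗ[ℚ] ℚ,
      ((LinearMap.mul ℚ (DualNumber (DualNumber ℚ))).compr₂ l).Nondegenerate :=
  ⟨_, dualNumber_dualNumber_nondegenerate⟩

/-! ## §3 REMARK 3.4 (iv), second half: `A` is not cyclic -/

/-- **Every element of `ℚ[x,y]/(x²,y²)` satisfies `(a − α)³ = 0`** for its constant coefficient `α` (the maximal
ideal `(x, y)` has `𝔪³ = 0`; indeed `(βx + γy + δxy)² = 2βγ·xy`). [cite: HertlingLarabi2026b, §3 Rem. 3.4 (iv), chunk p0006] -/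
theorem dualNumber_dualNumber_sub_algebraMap_pow_three (a : DualNumber (DualNumber ℚ)) :
    (a - algebraMap ℚ (DualNumber (DualNumber ℚ)) a.fst.fst) ^ 3 = 0 := by
  set n := a - algebraMap ℚ (DualNumber (DualNumber ℚ)) a.fst.fst with hn
  have hn0 : n.fst.fst = 0 := by
    simp [hn, TrivSqZeroExt.algebraMap_eq_inl']
  have hfst : n.fst = n.fst.snd • DualNumber.eps := by
    refine TrivSqZeroExt.ext ?_ ?_ <;> simp [hn0]
  have hfst2 : n.fst ^ 2 = 0 := by
    rw [hfst, _root_.smul_pow, sq (DualNumber.eps : DualNumber ℚ), DualNumber.eps_mul_eps, smul_zero]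
  refine TrivSqZeroExt.ext ?_ ?_
  · rw [TrivSqZeroExt.fst_pow, TrivSqZeroExt.fst_zero, pow_succ, hfst2, zero_mul]
  · rw [TrivSqZeroExt.snd_pow, TrivSqZeroExt.snd_zero]
    simp [hfst2]

/-- **`ℚ[a] ⊆ ℚ·1 + ℚ·a + ℚ·a²` for every `a ∈ ℚ[x,y]/(x²,y²)`** (every `p(a)` reduces modulo `(t − α)³`, which
annihilates `a`), so `dim_ℚ ℚ[a] ≤ 3`. [cite: HertlingLarabi2026b, §3 Rem. 3.4 (iv), chunk p0006] -/
theorem toSubmodule_adjoin_le_span (a : DualNumber (DualNumber ℚ)) :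
    Subalgebra.toSubmodule (Algebra.adjoin ℚ ({a} : Set (DualNumber (DualNumber ℚ)))) ≤
      Submodule.span ℚ (Set.range fun i : Fin 3 => a ^ (i : ℕ)) := by
  intro x hx
  rw [Subalgebra.mem_toSubmodule, Algebra.adjoin_singleton_eq_range_aeval, AlgHom.mem_range] at hx
  obtain ⟨p, rfl⟩ := hx
  have hq : ((X - C a.fst.fst) ^ 3 : ℚ[X]).Monic := (monic_X_sub_C _).pow 3
  have hq3 : ((X - C a.fst.fst) ^ 3 : ℚ[X]).natDegree = 3 := by
    rw [natDegree_pow, natDegree_X_sub_C, mul_one]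
  have hq1 : ((X - C a.fst.fst) ^ 3 : ℚ[X]) ≠ 1 := fun h => by
    have h' := congrArg natDegree h
    rw [hq3, natDegree_one] at h'
    exact absurd h' (by norm_num)
  have hroot : aeval a ((X - C a.fst.fst) ^ 3 : ℚ[X]) = 0 := by
    rw [map_pow, map_sub, aeval_X, aeval_C]
    exact dualNumber_dualNumber_sub_algebraMap_pow_three a
  rw [← Polynomial.aeval_modByMonic_eq_self_of_root (p := p) hroot]
  have hdeg : (p %ₘ (X - C a.fst.fst) ^ 3).natDegree < 3 := by
    have h := natDegree_modByMonic_lt p hq hq1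
    rwa [hq3] at h
  rw [aeval_eq_sum_range' hdeg]
  exact Submodule.sum_mem _ fun i hi =>
    Submodule.smul_mem _ _ (Submodule.subset_span ⟨⟨i, Finset.mem_range.1 hi⟩, rfl⟩)

/-- **REMARK 3.4 (iv), «but not cyclic»: no `a` generates `ℚ[x, y]/(x², y²)` as a `ℚ`-algebra** (`dim ℚ[a] ≤ 3 <
4`). [cite: HertlingLarabi2026b, §3 Def. 3.3 (a) and Rem. 3.4 (iv), chunk p0006] -/
theorem dualNumber_dualNumber_not_cyclic :
    ¬ ∃ a : DualNumber (DualNumber ℚ), Algebra.adjoin ℚ ({a} : Set (DualNumber (DualNumber ℚ))) = ⊤ := by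
  rintro ⟨a, ha⟩
  have hle := toSubmodule_adjoin_le_span a
  rw [ha, Algebra.top_toSubmodule, top_le_iff] at hle
  have h3 := finrank_range_le_card (R := ℚ) fun i : Fin 3 => a ^ (i : ℕ)
  rw [Set.finrank, hle, finrank_top, finrank_dualNumber_dualNumber, Fintype.card_fin] at h3
  omega

/-- **REMARK 3.4 (iv) (Hertling–Larabi 2026b).** «The algebra `A = ℚ[x,y]/(x²,y²)` is Gorenstein, but not cyclic.»
Here `A = ℚ[ε₁][ε₂]` (`dualNumber_dualNumber_presentation`), «Gorenstein» in the form HL use it — `A` has a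
multiplicative metric (Def. 3.3 (b): «If `A` has a multiplicative metric then `A` is a Gorenstein ring», and
conversely by Rem. 3.4 (i)) — and «cyclic» = `A = ℚ[a]` for some `a` (Def. 3.3 (a)).
[cite: HertlingLarabi2026b, §3 Rem. 3.4 (iv), chunk p0006] -/
theorem dualNumber_dualNumber_gorenstein_not_cyclic :
    (∃ l : DualNumber (DualNumber ℚ) →ₗ[ℚ] ℚ,
        ((LinearMap.mul ℚ (DualNumber (DualNumber ℚ))).compr₂ l).Nondegenerate) ∧
      ¬ ∃ a : DualNumber (DualNumber ℚ), Algebra.adjoin ℚ ({a} : Set (DualNumber (DualNumber ℚ))) = ⊤ :=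
  ⟨dualNumber_dualNumber_exists_nondegenerate, dualNumber_dualNumber_not_cyclic⟩

end Literature.NumberTheory.ComplexMultiplication.FiniteQAlgebraLattice
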